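import Summits.Ventures.HodgeKum4.Invariants

/-!
# H3 / Kum⁴ — lemma node L2 (motivic bookkeeping)

Cell `hodge-kum4` (ladder HodgeAV, rung H3), namespace `Summit.Ventures.HodgeKum4`.  HONEST FRAMING: nothing
here asserts that a case of the Hodge conjecture is proved.  Every `def … : Prop` is a STATEMENT — an
obligation of the cell or a print input offered for vendoring — and every `theorem` is kernel glue
(standard axioms, no `sorry`).  H3 is a rung, not a thesis: nothing is glued to `Summit.HodgeConjecture`.
This module is one topic of the FROZEN TYPING (planner seat; semantic audit PASS 5934162d on the
single-file form sha16 e3550acdea16baa3, of which the present files are a split by topic with no change of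
any statement or proof); the INDEX is `Summits/Ventures/HodgeKum4/Statement.lean`.

## §3 L2 — motivic bookkeeping.  GRADE-LOAD node: all print inputs REFEREED (lit round 1)
OFFICIAL `MotivicBookkeepingKum4 := LefschetzGenerationKum4 → InvariantHodgeClassesAlgebraicKum4`
(the consequent is p2's L2′ verbatim: every `Γ(X)`-invariant rational `(p,p)`-class is algebraic).
Second layer making ref items G2 (fullness) and G3 (`⟨⟩_Mot` convention) FORMAL on the tree's
cycle-level carriers (`HodgeTheory.IsAlgebraicCorrespondence`, `Motives.SchemeOver.pow`):
L2a `GammaInvariantsRetractKum4` (`h(X)^Γ` is a retract, through algebraic correspondences, of a sum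
of twisted powers of a FOURFOLD `B` — intended `J³(X)` — whose powers satisfy HC), L2c
`RetractHodgeClassesAlgebraic` (general bookkeeping: correspondences carry rational Hodge classes and
algebraic classes), KERNEL glue `motivicBookkeepingKum4_of : L2a → L2c → L2`.  Print inputs BY NAME
for L2a's closing theorem: `Foster2024_lefschetzStandard_kummerType_prime` (B(X); tree), hard
Lefschetz (tree, hodge.S14), `Markman2023_thirdCohomology_kummerType_discOneWeilFourfold` (lit
p404171: `J³(X)` disc-1 Weil fourfold + algebraic `H¹(J³X) ≅ H³(X)`; O'Grady21 Thm 1.5, Markman23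
Thm 1.4/§12), Voisin22 Thm 4.1 (KSHC) with O'Grady21 Thm 1.5 (`KS(X,L) ~ J³(X)⁴`, flag F5),
`FloccariFu2026_hodgeClasses_algebraic_powers_discOneWeilFourfold` (tree; = Floccari26 Thm 5.12),
Lieberman / André–Jannsen semisimplicity given B (formalism), FV24 Lem 4.2 (pattern).  The support
statement `PolarizationHasDualLefschetz` (S1) is listed so that no step of L2 is smuggled.
-/

noncomputable section

open CategoryTheory
open Literature.AlgebraicTopology.SingularHomology
open Literature.AlgebraicGeometry Literature.AlgebraicGeometry.HodgeTheory
  Literature.AlgebraicGeometry.Hyperkaehler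

namespace Summit.Ventures.HodgeKum4

-- commutator bracket on `gl(H*)`, Mathlib's local-instance idiom (as in `Hyperkaehler/LooijengaLuntsVerbitsky`)
attribute [local instance 100] LieRing.ofAssociativeRing

/-! ### §3 L2 — motivic bookkeeping -/

/-- **Every `Γ(X)`-invariant rational Hodge class on a smooth projective `Kum⁴`-type `X` is algebraic**
(the conclusion of L2). -/
def InvariantHodgeClassesAlgebraicKum4 : Prop :=
  ∀ ⦃X : Motives.SchemeOver ℂ⦄, Motives.IsSmoothProjective 8 X → IsOfGeneralizedKummerType 4 X →
    ∀ (p : ℕ) (c : complexBetti X (2 * p)), IsRationalClass c → IsOfHodgeType 8 X (2 * p) p p c →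
      IsGammaInvariant X c → c ∈ algebraicClasses X p

/-- **L2 (OFFICIAL) — motivic bookkeeping: given L1, every `Γ(X)`-invariant rational `(p,p)`-class of a
smooth projective `Kum⁴`-type `X` is algebraic.**  GRADE-LOAD-BEARING node of the rung (director,
ref, lit, p1, p2, plan agree); its print inputs are all REFEREED (HOME/lit/LIT-GRADES-r1 §2 rows
L2.1–L2.11): Foster 2024 Cor. 2 (`B(X)`, `n + 1 = 5` prime; EJM 2024); hard Lefschetz (tree, hodge.S14);
Markman 2023 (JEMS 25; arXiv:1805.11574 Thm. 1.4: `h³(X) ≅ h¹(J³X)(-1)` by an algebraic cycle);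
Voisin 2022 Thm. 4.1 (KSHC(X)) with O'Grady 2021 Thm. 1.5 (`KS(X,L) ~ J³(X)⁴` for EVERY polarised `X`,
flag F5); Markman 2023 §12 (`J³(X)` of Weil type, discriminant `1`); Floccari 2026 = Geom. Topol. 30
Thm. 5.12 / Floccari–Fu 2026 Thm. 1.2 (HC for all powers of disc-1 Weil fourfolds; tree fact
`HodgeTheory.FloccariFu2026_hodgeClasses_algebraic_powers_discOneWeilFourfold`); FV24 Lem. 4.2
(pattern); André 1996 / Arapura 2006 (formalism).  Typed decomposition making ref items G2/G3 formal:
`GammaInvariantsRetractKum4` (L2a) ∧ `RetractHodgeClassesAlgebraic` (L2c) ⟹ L2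
(`motivicBookkeepingKum4_of`). -/
def MotivicBookkeepingKum4 : Prop :=
  LefschetzGenerationKum4 → InvariantHodgeClassesAlgebraicKum4

/-- **Support S1 (classical, REFEREED; NOT in the tree) — a polarisation class has a dual Lefschetz
operator**: hard Lefschetz for `η` (a field of `HodgeTheory.IsPolarizationClass`) ⟹
`∃ Λ, IsDualLefschetz n η Λ` on `H*(X(ℂ); ℂ)` (the Lefschetz `sl(2)`; "by Jacobson–Morozov", LL97 §1
p. 4 — the equivalence the tree's `Hyperkaehler.HasDualLefschetz` docstring leaves unproved).  Needed
by the closing theorem of L2a / L2a′ to instantiate L1 at an ample class `η`, where `Λ_η` is moreover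
an algebraic correspondence by Foster's `B(X)` (`Foster2024_lefschetzStandard_kummerType_prime`,
`*_L` algebraic, `Λ = *_L ∘ L ∘ *_L`) — listed so that no step of L2 is smuggled. -/
def PolarizationHasDualLefschetz : Prop :=
  ∀ ⦃n : ℕ⦄ ⦃X : Motives.SchemeOver ℂ⦄ (η : complexBetti X 2), IsPolarizationClass n X η →
    HasDualLefschetz n η

/-- **L2a — the `Γ(X)`-invariant part of `h(X)` is a retract, by algebraic correspondences, of a sum of
twisted powers of an abelian FOURFOLD all of whose powers satisfy the Hodge conjecture** (intended:
`B = J³(X)`, a Weil-type abelian fourfold of discriminant `1`).  Cycle-level rendering of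
"`h(X)^Γ ∈ ⟨h¹(J³(X))⟩` in `Mot_hom`" (ref item G3 — the `⟨⟩_Mot` convention — fixed as: homological
motives, direct summands of finite sums of Tate twists of powers `B^e`, morphisms = algebraic
correspondences `HodgeTheory.IsAlgebraicCorrespondence`; no André motivated cycles needed, G2-AUDIT §A1):
given L1, for every smooth projective `Kum⁴`-type `X` there are a smooth projective `B` of dimension `4`
with `HodgeConjectureFor` for all powers `B^{m+1}`, and in every degree `k` finitely many pairs of
algebraic correspondences `uᵢ : Hᵏ(X) → H^{aᵢ}(B^{eᵢ})`, `vᵢ : H^{aᵢ}(B^{eᵢ}) → Hᵏ(X)` with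
`∑ᵢ vᵢ(uᵢ c) = c` for every `Γ(X)`-invariant `c ∈ Hᵏ(X(ℂ); ℂ)`.  CONTENT (the blueprint, CENSUS §3,
G2-AUDIT §D (2)–(4)): `𝔫 := ⟨h⁰, h², h³⟩_{(Λ_ℓ, ∪)} ⊂ h(X)` exists as a motive because `Λ_ℓ` (Foster
`B(X)`) and the cup product (diagonal) are algebraic; `h²(X) ∈ ⟨h¹(KS(X))⟩ = ⟨h¹(J³X)⟩` (Voisin KSHC +
O'Grady), `h³(X) ≅ h¹(J³X)(-1)` (Markman); hence `𝔫 ∈ ⟨h¹(J³X)⟩`; `H(𝔫) ⊇ H*(X)^Γ` by L1; HC for the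
powers of `J³(X)` by Floccari 5.12. -/
def GammaInvariantsRetractKum4 : Prop :=
  LefschetzGenerationKum4 →
    ∀ ⦃X : Motives.SchemeOver ℂ⦄, Motives.IsSmoothProjective 8 X → IsOfGeneralizedKummerType 4 X →
      ∃ B : Motives.SchemeOver ℂ, Motives.IsSmoothProjective 4 B ∧
        (∀ m : ℕ, HodgeConjectureFor ((m + 1) * 4) (B.pow (m + 1))) ∧
        ∀ k : ℕ, ∃ (ι : Type) (_ : Fintype ι) (e a : ι → ℕ)
          (u : (i : ι) → (complexBetti X k →ₗ[ℂ] complexBetti (B.pow (e i)) (a i)))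
          (v : (i : ι) → (complexBetti (B.pow (e i)) (a i) →ₗ[ℂ] complexBetti X k)),
          (∀ i, IsAlgebraicCorrespondence (e i * 4) 8 (B.pow (e i)) X (u i)) ∧
          (∀ i, IsAlgebraicCorrespondence 8 (e i * 4) X (B.pow (e i)) (v i)) ∧
          ∀ c : complexBetti X k, IsGammaInvariant X c → ∑ i, v i (u i c) = c

/-- **L2c — a rational Hodge class fixed by a finite sum `∑ vᵢ ∘ uᵢ` of composites of algebraic
correspondences through powers of `B` is algebraic, when the Hodge conjecture holds on those powers**
(general `B`, `Y`; ref item G2 "fullness" in cycle form — the Arapura 2006 Lem. 4.2 / André mechanism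
WITHOUT semisimplicity: `uᵢ c` is a rational Hodge class on `B^{eᵢ}` (algebraic correspondences are
morphisms of rational Hodge structures), hence algebraic, and `vᵢ` carries algebraic classes to
algebraic classes).  KERNEL target over the tree's correspondence files
(`CorrespondenceActionHodgeClasses`, `AlgebraicClassesPullback`, `GysinFormalism`). -/
def RetractHodgeClassesAlgebraic : Prop :=
  ∀ ⦃dB : ℕ⦄ ⦃B : Motives.SchemeOver ℂ⦄ ⦃dY : ℕ⦄ ⦃Y : Motives.SchemeOver ℂ⦄,
    Motives.IsSmoothProjective dB B → Motives.IsSmoothProjective dY Y →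
      (∀ m : ℕ, HodgeConjectureFor ((m + 1) * dB) (B.pow (m + 1))) →
        ∀ (p : ℕ) (ι : Type) [Fintype ι] (e a : ι → ℕ)
          (u : (i : ι) → (complexBetti Y (2 * p) →ₗ[ℂ] complexBetti (B.pow (e i)) (a i)))
          (v : (i : ι) → (complexBetti (B.pow (e i)) (a i) →ₗ[ℂ] complexBetti Y (2 * p))),
          (∀ i, IsAlgebraicCorrespondence (e i * dB) dY (B.pow (e i)) Y (u i)) →
          (∀ i, IsAlgebraicCorrespondence dY (e i * dB) Y (B.pow (e i)) (v i)) →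
            ∀ c : complexBetti Y (2 * p), IsRationalClass c → IsOfHodgeType dY Y (2 * p) p p c →
              ∑ i, v i (u i c) = c → c ∈ algebraicClasses Y p

/-- **KERNEL glue: L2a ∧ L2c ⟹ L2.** -/
theorem motivicBookkeepingKum4_of (ha : GammaInvariantsRetractKum4) (hc : RetractHodgeClassesAlgebraic) :
    MotivicBookkeepingKum4 := by
  intro h1 X hX hK p c hrat hpp hinv
  obtain ⟨B, hB, hHC, hret⟩ := ha h1 hX hK
  obtain ⟨ι, _, e, a, u, v, hu, hv, hsum⟩ := hret (2 * p)
  exact hc hB hX hHC p ι e a u v hu hv c hrat hpp (hsum c hinv)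

end Summit.Ventures.HodgeKum4

end
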